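import Summits.QuantumFields.YangMills.Theorems.UnitScaleTiltProp7GaugeModeHessianRow
import Summits.QuantumFields.YangMills.Theorems.UnitScaleTiltProp7OneFormGradientSupNabla
import Summits.QuantumFields.YangMills.Theorems.UnitScaleTiltProp7GreenOnPureGaugeSources
import Summits.QuantumFields.YangMills.Theorems.UnitScaleTiltProp7CurrentPairingPointwise
import HarnessLib

/-!
# Route `UnitScaleTilt`, crux K1 «MinimiserStabilityRegPr» (stmt-QuantumFields-19200), EX row `norm_G` (S47 ✓p766895), NORM_G ROAD (★p1 g27 CHAIR WORDs №24∕№28∕№33) —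
# **(H∇)-KNIT: THE (115)-HESSIAN ROW OF THE CHAIN POTENTIAL `λ = G′ᴾR_SG′ᴾ(g)`** — the (∇1)-KNIT's letter `hHD` (✓∕⧗`Prop7GreenOneGradientRowOfLetters.gradient_row_GTone_of_letters`)
# from HESS-T1 (✓p768631) fed by the scalar-storey letters (c1)(c3), the (3.117) current pairing (C-val), and ONE displayed letter (Dg): the gradient row of `R_SG′ᴾ` on site sources.

Cell `ym3-torus` (HUMAN RULING D-0037; rung R3 = SU(2) YM₃ on T³ — NOT d = 4, NOT infinite volume, NOT a mass gap, NOT Clay).  Width seat `ym3-torus-px17` (gen 12).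
THEOREMS ONLY (0 `def`, 0 `sorry`, default heartbeats); `--supports stmt-QuantumFields-19200 --as helper`; count-neutral.

WHY.  In the six-term identity for `G₁` (✓`GT_one_eq_six_terms`) two terms are bare gradients `Dλ₂`, `Dλ₃` of CHAIN potentials `λ = G′ᴾ(R_S(G′ᴾ jj))`; the (∇1)-KNIT displays their
(115)-gradient as the letter (H∇) `∀ v m, ‖v‖_∞ ≤ m → ‖∇_{U₀}(toL2⁻¹(D(G′ᴾR_SG′ᴾ(toL2S v))) ∘ bondEquiv⁻¹)‖ ≤ BH·m`.  THIS FILE supplies it: `ψ := G′ᴾ(R_S(G′ᴾ(toL2S v)))` is a residual pure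
gauge mode (`ψ ∈ N_S`, ✓`GprimeP_RS_mem_NS`) with `Δ^η_{U₀}ψ = R_S(G′ᴾ(toL2S v))` (✓`covLapSite_GprimeP_RS`), so HESS-T1 ✓`Prop7GaugeModeHessianRow.norm_covGradT_DL2_le_DeltaEtaSlot` bounds every
second covariant derivative of `ψ` by its four letters, which are FED here: `M_ψ = √2·C₁C₃·m` ((c3) then (c1) after `R_SR_S = R_S`, and the torus∕route dictionary `‖w‖ ≤ √2‖frobEquiv w‖`),
`M_φ = √2·C₃·m` ((c3)), `M_E = 4α·C₁C₃·m` ((C-val) ✓`norm_symm_DeltaEta_DL2_toL2S_apply_le_of_sup`), `G_φ = C_Dg·m` ((Dg), displayed); the (115) dictionary ✓`nabla115_bgOfCfg_eq_covGradT`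
turns the componentwise bound into the sup norm of `nabla115`.

WHAT IS PROVED (ns `Summit.QuantumFields.YangMills.Theorems.Prop7ChainPotentialHessianRow`; member `F`, `h : n ≤ K`, weights `c₀ cB`, pseudo-inverse parameter `0 ≤ a`).
* §1 `norm_equiv_le_sqrt_two_of_route_sup` — the torus∕route sup dictionary `‖(WL2.equiv g)(x)‖_{W₂} ≤ √2·sup_y ‖toL2S⁻¹ g y‖`.
* §2 ★★ `norm_covGradT_DL2_chain_le_of_letters` — the componentwise Hessian row of the chain potential from (c1)(c3)(Dg) at `RegPr F n K α U₀`, `0 < α ≤ 1`, room, margin.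
* §3 ★★★ `hessRow_chain_of_letters` — (∇1)'s `hHD` TEXT VERBATIM: `∀ v m, (∀ x, ‖v x‖ ≤ m) → ‖nabla115 ((L⁻¹)^(K−n)) (bgOfCfg F K U₀) (fun q => toL2⁻¹(D(G′ᴾ(R_S(G′ᴾ(toL2S v))))) (bondEquiv⁻¹ q))‖ ≤ BH·m`
  with `BH` = HESS-T1's displayed bound at (`M_ψ, M_φ, G_φ, M_E`) = (`√2C₁C₃, √2C₃, C_Dg, 4αC₁C₃`) per unit `m` (LINEAR in `m`).
HYP-SAT (★★OWNER RULING №42): `RegPr F n K α U₀` + `0 < α ≤ 1` (EX class); (c1)(c3) ⟸ px5's (c)-package (route editions ✓`Prop7GaugeProjectorSupPackageMember`, W-files); (Dg) = the sup row of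
`D_{U₀}R_SG′ᴾ` on site sources — the P4a class ✓`Prop7PcolOfGradientRow.DL2_RS_GprimeP_eq_of_sourceForm` («the gradient falls on the massive Green alone», K-free at the pins), displayed;
`hroom` = CHAIR WORD №1 class; `hsmall` = T1's margin (`.choose`-window class of record).  All letters are linear sup rows; conclusions non-vacuous; no `Prop` placeholder.
HONEST SCOPE.  Composition of landed theorems (HESS-T1, (G-iii)'s pure-gauge facts, the (115) dictionary); the max-principle analysis is T1-core's, not re-done; nothing of the letters,
`norm_G`, the eight EX print rows, `hThm2S`, EX `stub_existenceMinimalOrbit`, `MinimiserStabilityRegPr` (19200) or R3 is proved; the Yang–Mills mass gap is NOT proved.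

References: T. Bałaban, CMP **99** (1985) 389–434 [Balaban1985BackgroundPropagators] ((3.3) p.391, (3.21)–(3.25) p.394, (3.115)–(3.119) pp.418–419, Thm 3.1 (3.42)–(3.45) pp.397–398,
(3.138) p.423); CMP **102** (1985) 277–309 [Balaban1985Variational] ((19) p.281, (115)–(117) pp.294–295, (134)–(135) p.298).
-/

set_option autoImplicit false

noncomputable section

open scoped BigOperators Matrix.Norms.L2Operator InnerProductSpace ComplexConjugate

namespace Summit.QuantumFields.YangMills.Theorems.Prop7ChainPotentialHessianRow

open Literature.MathematicalPhysics.QuantumFieldTheory.Balaban1983to89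
open Literature.MathematicalPhysics.QuantumFieldTheory.Balaban1983to89.T3ContinuumYM3Torus
open T3PrintedRegularMinimiser (RegPr)
open T3SectALandauChart (covGradT bgUnits eta eta_pos)
open B4Sect5Torus (TSite)
open B9SectCLatticeCarrier (Bond)
open B9Eq311L2Pairing (WL2)
open B11Eq111FrakG (nabla115)
open B11Eq103H1Complex (SiteL2K BondL2K)
open Summit.QuantumFields.YangMills.Theorems.Prop7SectET3Transport (periodsT3 siteEquiv bondEquiv bgOfCfg)
open Summit.QuantumFields.YangMills.Theorems.Prop7SectET3HilbertLetters (W₂ frobEquiv toL2 toL2S DL2 DstarL2 covLapSite toL2S_symm_apply)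
open Summit.QuantumFields.YangMills.Theorems.Prop7SectET3GaugeProjector (NS RS RS_RS)
open Summit.QuantumFields.YangMills.Theorems.Prop7SectET3WilsonHessian (DeltaEta DeltaEtaSlot)
open Summit.QuantumFields.YangMills.Theorems.Prop7SectET3DeltaPiPInv (GprimeP)
open Summit.QuantumFields.YangMills.Theorems.Prop7RieszTauFrobNorm (norm_le_sqrt_two_mul_norm_frobEquiv)
open Summit.QuantumFields.YangMills.Theorems.Prop7CurvedMemberLocalGradient (exists_curved_localGradient)
open Summit.QuantumFields.YangMills.Theorems.AxialGaugeChartGlue (norm_bgOfCfg_axialT_sub_le)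
open Summit.QuantumFields.YangMills.Theorems.Prop7GaugeModeHessianRow (norm_covGradT_DL2_le_DeltaEtaSlot)
open Summit.QuantumFields.YangMills.Theorems.Prop7OneFormGradientSupNabla (nabla115_bgOfCfg_eq_covGradT)
open Summit.QuantumFields.YangMills.Theorems.Prop7GreenOnPureGaugeSources (GprimeP_RS_mem_NS covLapSite_GprimeP_RS)
open Summit.QuantumFields.YangMills.Theorems.Prop7CurrentPairingPointwise (norm_symm_DeltaEta_DL2_toL2S_apply_le_of_sup)

variable (F : T3Family) {n K : ℕ} (h : n ≤ K) (c₀ cB : ℝ) [Fact (0 < c₀)] [Fact (0 < cB)] (a : ℝ)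

/-! ## §1 The torus∕route sup dictionary -/

omit [Fact (0 < c₀)] [Fact (0 < cB)] in
/-- **`‖(WL2.equiv g)(x)‖_{W₂} ≤ √2 · M` whenever `‖toL2S⁻¹ g y‖ ≤ M` for all route sites `y`** (`toL2S⁻¹ g y = frobEquiv (g (siteEquiv y))`, ✓`toL2S_symm_apply`; the Frobenius norm of a
`2 × 2` matrix is at most `√2` times its operator norm, ✓`norm_le_sqrt_two_mul_norm_frobEquiv`). [cite: Balaban1985BackgroundPropagators, (3.11) p.392] -/
theorem norm_equiv_le_sqrt_two_of_route_sup (g : SiteL2K ℂ 3 (periodsT3 F K) c₀ W₂) {M : ℝ}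
    (hM : ∀ y : Site (F.P K) 0, ‖(toL2S F K c₀).symm g y‖ ≤ M) (x : TSite 3 (periodsT3 F K)) :
    ‖WL2.equiv ℂ (fun _ : TSite 3 (periodsT3 F K) => c₀) W₂ g x‖ ≤ Real.sqrt 2 * M := by
  have hx : siteEquiv F K ((siteEquiv F K).symm x) = x := Equiv.apply_symm_apply _ _
  have h1 := norm_le_sqrt_two_mul_norm_frobEquiv (WL2.equiv ℂ (fun _ : TSite 3 (periodsT3 F K) => c₀) W₂ g x)
  have h2 : ‖frobEquiv (WL2.equiv ℂ (fun _ : TSite 3 (periodsT3 F K) => c₀) W₂ g x)‖ ≤ M := by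
    have e := hM ((siteEquiv F K).symm x)
    rwa [toL2S_symm_apply, hx] at e
  exact h1.trans (mul_le_mul_of_nonneg_left h2 (Real.sqrt_nonneg _))

/-! ## §2 ★★ The componentwise Hessian row of the chain potential -/

/-- ★★ **EVERY SECOND COVARIANT DERIVATIVE OF THE CHAIN POTENTIAL `ψ = G′ᴾR_SG′ᴾ(toL2S v)` IS BOUNDED BY `‖v‖_∞`** — HESS-T1 ✓`norm_covGradT_DL2_le_DeltaEtaSlot` at `ψ ∈ N_S`
(✓`GprimeP_RS_mem_NS`), `Δ^ηψ = R_SG′ᴾ(toL2S v)` (✓`covLapSite_GprimeP_RS`), with `M_ψ := √2·C₁·(C₃·m)` ((c3), `R_SR_S = R_S`, (c1), §1), `M_φ := √2·(C₃·m)` ((c3), §1), `G_φ := C_Dg·m` ((Dg)),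
`M_E := 4α·(C₁·(C₃·m))` ((C-val)).  [cite: Balaban1985BackgroundPropagators, (3.21)–(3.25) p.394, (3.115)–(3.117) pp.418–419, Thm 3.1 (3.42)–(3.45) pp.397–398; Balaban1985Variational, (19) p.281] -/
theorem norm_covGradT_DL2_chain_le_of_letters {α : ℝ} (hα0 : 0 < α) (hα1 : α ≤ 1) (U₀ : GaugeField (F.P K) 0 (Matrix.specialUnitaryGroup (Fin 2) ℂ)) (hreg : RegPr F n K α U₀)
    (ha : 0 ≤ a) {C₁ C₃ CDg : ℝ} (hC₁ : 0 ≤ C₁) (hC₃ : 0 ≤ C₃) (hCDg : 0 ≤ CDg)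
    (hc1 : ∀ (v : Site (F.P K) 0 → Matrix (Fin 2) (Fin 2) ℂ) (m : ℝ), (∀ x, ‖v x‖ ≤ m) →
      ∀ x, ‖(toL2S F K c₀).symm (GprimeP F n K h c₀ cB a U₀ (RS F n K h c₀ cB U₀ (toL2S F K c₀ v))) x‖ ≤ C₁ * m)
    (hc3 : ∀ (v : Site (F.P K) 0 → Matrix (Fin 2) (Fin 2) ℂ) (m : ℝ), (∀ x, ‖v x‖ ≤ m) →
      ∀ x, ‖(toL2S F K c₀).symm (RS F n K h c₀ cB U₀ (GprimeP F n K h c₀ cB a U₀ (toL2S F K c₀ v))) x‖ ≤ C₃ * m)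
    (hDg : ∀ (v : Site (F.P K) 0 → Matrix (Fin 2) (Fin 2) ℂ) (m : ℝ), (∀ x, ‖v x‖ ≤ m) →
      ∀ b, ‖(toL2 F K c₀).symm (DL2 F n K c₀ U₀ (RS F n K h c₀ cB U₀ (GprimeP F n K h c₀ cB a U₀ (toL2S F K c₀ v)))) b‖ ≤ CDg * m)
    (hroom : 2 * (12 * F.L ^ (K - n) + 5) ≤ (F.P K).sitesPerDir 0)
    (hsmall : exists_curved_localGradient.choose * ((48 * α) * (6 * Real.sqrt 2 * Real.sqrt 10 + 6 * Real.sqrt 2)) ≤ 1 / 2)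
    (v : Site (F.P K) 0 → Matrix (Fin 2) (Fin 2) ℂ) {m : ℝ} (hv : ∀ x, ‖v x‖ ≤ m)
    (μ ν : Fin (F.P K).d) (x : Site (F.P K) 0) :
    ‖covGradT (eta F n K) (bgUnits F K U₀)
        ((toL2 F K c₀).symm (DL2 F n K c₀ U₀ (GprimeP F n K h c₀ cB a U₀ (RS F n K h c₀ cB U₀ (GprimeP F n K h c₀ cB a U₀ (toL2S F K c₀ v)))))) μ ν x‖
      ≤ 2 * (exists_curved_localGradient.choose * ((Real.sqrt 2 * (2 * (exists_curved_localGradient.choose * ((Real.sqrt 2 * (C₁ * (C₃ * m))) * (2 + 2 * Real.sqrt 2 * (4 * α * (3 + 2457 * norm_bgOfCfg_axialT_sub_le.choose)) + (24 * Real.sqrt 10 + 48) * (48 * α) ^ 2) + (Real.sqrt 2 * (C₃ * m))) + 2 * Real.sqrt 2 * (48 * α) * (Real.sqrt 2 * (C₁ * (C₃ * m)))))) * (2 + 2 * Real.sqrt 2 * (4 * α * (3 + 2457 * norm_bgOfCfg_axialT_sub_le.choose)) + (24 * Real.sqrt 10 + 48) * (48 * α) ^ 2) + (Real.sqrt 2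 * (32 * α * (2 * (exists_curved_localGradient.choose * ((Real.sqrt 2 * (C₁ * (C₃ * m))) * (2 + 2 * Real.sqrt 2 * (4 * α * (3 + 2457 * norm_bgOfCfg_axialT_sub_le.choose)) + (24 * Real.sqrt 10 + 48) * (48 * α) ^ 2) + (Real.sqrt 2 * (C₃ * m))) + 2 * Real.sqrt 2 * (48 * α) * (Real.sqrt 2 * (C₁ * (C₃ * m))))) + ((4 * α * (C₁ * (C₃ * m))) + (4 * α * (C₁ * (C₃ * m)))) + 0 + 0 + ((4 * α * (C₁ * (C₃ * m))) + CDg * m)))) + 2 * Real.sqrt 2 * (48 * α) * (Real.sqrt 2 * (2 * (exists_curved_localGradient.choose * ((Real.sqrt 2 * (C₁ * (C₃ * m))) * (2 + 2 * Real.sqrt 2 * (4 * α * (3 + 2457 * norm_bgOfCfg_axialT_sub_le.choose)) + (24 * Real.sqrt 10 + 48) * (48 * α) ^ 2) + (Real.sqrt 2 * (C₃ * m))) + 2 * Real.sqrt 2 * (48 * α) * (Real.sqrt 2 * (C₁ * (C₃ * m))))))) := by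
  -- the objects
  set g : SiteL2K ℂ 3 (periodsT3 F K) c₀ W₂ := GprimeP F n K h c₀ cB a U₀ (toL2S F K c₀ v) with hg
  set ψ : SiteL2K ℂ 3 (periodsT3 F K) c₀ W₂ := GprimeP F n K h c₀ cB a U₀ (RS F n K h c₀ cB U₀ g) with hψ
  have hψNS : ψ ∈ NS F n K h c₀ cB U₀ := GprimeP_RS_mem_NS ha U₀ g
  have hφ : covLapSite F n K c₀ U₀ ψ = RS F n K h c₀ cB U₀ g := covLapSite_GprimeP_RS ha U₀ g
  have hm : 0 ≤ m := (norm_nonneg _).trans (hv (Classical.arbitrary _))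
  -- (c3): the projected source in route sup
  have hGv : ∀ y, ‖(toL2S F K c₀).symm (RS F n K h c₀ cB U₀ g) y‖ ≤ C₃ * m := fun y => hc3 v m hv y
  -- (c1) after `R_SR_S = R_S`: the potential in route sup
  set Gv : Site (F.P K) 0 → Matrix (Fin 2) (Fin 2) ℂ := (toL2S F K c₀).symm (RS F n K h c₀ cB U₀ g) with hGvd
  have hGveq : toL2S F K c₀ Gv = RS F n K h c₀ cB U₀ g := LinearEquiv.apply_symm_apply _ _
  have hψeq : ψ = GprimeP F n K h c₀ cB a U₀ (RS F n K h c₀ cB U₀ (toL2S F K c₀ Gv)) := by rw [hGveq, RS_RS]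
  have hψsup : ∀ y, ‖(toL2S F K c₀).symm ψ y‖ ≤ C₁ * (C₃ * m) := fun y => by rw [hψeq]; exact hc1 Gv _ hGv y
  -- the four HESS-T1 letters
  have hMψ : ∀ z : TSite 3 (periodsT3 F K), ‖WL2.equiv ℂ (fun _ : TSite 3 (periodsT3 F K) => c₀) W₂ ψ z‖ ≤ Real.sqrt 2 * (C₁ * (C₃ * m)) :=
    norm_equiv_le_sqrt_two_of_route_sup F c₀ ψ hψsup
  have hMφ : ∀ z : TSite 3 (periodsT3 F K), ‖WL2.equiv ℂ (fun _ : TSite 3 (periodsT3 F K) => c₀) W₂ (covLapSite F n K c₀ U₀ ψ) z‖ ≤ Real.sqrt 2 * (C₃ * m) := by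
    rw [hφ]; exact norm_equiv_le_sqrt_two_of_route_sup F c₀ _ hGv
  have hGφ : ∀ b : PBond (F.P K) 0, ‖(toL2 F K c₀).symm (DL2 F n K c₀ U₀ (covLapSite F n K c₀ U₀ ψ)) b‖ ≤ CDg * m := by
    intro b; rw [hφ, hg]; exact hDg v m hv b
  have hME : ∀ b : PBond (F.P K) 0, ‖(toL2 F K c₀).symm ((DeltaEta F n K c₀ U₀ : BondL2K ℂ 3 (periodsT3 F K) c₀ W₂ →ₗ[ℂ] BondL2K ℂ 3 (periodsT3 F K) c₀ W₂)
      (DL2 F n K c₀ U₀ ψ)) b‖ ≤ 4 * α * (C₁ * (C₃ * m)) := by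
    intro b
    have e : ψ = toL2S F K c₀ ((toL2S F K c₀).symm ψ) := (LinearEquiv.apply_symm_apply _ _).symm
    rw [e]
    exact norm_symm_DeltaEta_DL2_toL2S_apply_le_of_sup U₀ hreg _ hψsup b
  have h0ψ : 0 ≤ Real.sqrt 2 * (C₁ * (C₃ * m)) := by positivity
  have h0φ : 0 ≤ Real.sqrt 2 * (C₃ * m) := by positivity
  have h0G : 0 ≤ CDg * m := by positivity
  have h0E : 0 ≤ 4 * α * (C₁ * (C₃ * m)) := by have := hα0.le; positivity
  exact norm_covGradT_DL2_le_DeltaEtaSlot F h c₀ cB U₀ hα0 hα1 hreg hψNS h0ψ h0φ h0G h0E hMψ hMφ hGφ hME hroom hsmall μ ν x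

/-! ## §3 ★★★ The (115)-Hessian row of the chain potential: (∇1)'s `hHD` letter -/

/-- ★★★ **(H∇) = THE (∇1)-KNIT's `hHD` LETTER**: at `RegPr F n K α U₀` (`0 < α ≤ 1`), `0 ≤ a`, from (c1)(c3)(Dg), the room and T1's margin:
`∀ v m, (∀ x, ‖v x‖ ≤ m) → ‖nabla115 ((L⁻¹)^(K−n)) (bgOfCfg F K U₀) (fun q => toL2⁻¹(D_{U₀}(G′ᴾ(R_S(G′ᴾ(toL2S v))))) (bondEquiv⁻¹ q))‖ ≤ BH·m` with `BH` = §2's bound per unit `m`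
(the (115) dictionary ✓`nabla115_bgOfCfg_eq_covGradT`; the Pi sup norm over `Bond × Fin 3`; `η = (L⁻¹)^(K−n)` by `rfl`).
[cite: Balaban1985Variational, (19) p.281, (115)–(117) pp.294–295; Balaban1985BackgroundPropagators, (3.3) p.391, Thm 3.1 (3.42)–(3.45) pp.397–398, (3.138) p.423] -/
theorem hessRow_chain_of_letters {α : ℝ} (hα0 : 0 < α) (hα1 : α ≤ 1) (U₀ : GaugeField (F.P K) 0 (Matrix.specialUnitaryGroup (Fin 2) ℂ)) (hreg : RegPr F n K α U₀)
    (ha : 0 ≤ a) {C₁ C₃ CDg : ℝ} (hC₁ : 0 ≤ C₁) (hC₃ : 0 ≤ C₃) (hCDg : 0 ≤ CDg)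
    (hc1 : ∀ (v : Site (F.P K) 0 → Matrix (Fin 2) (Fin 2) ℂ) (m : ℝ), (∀ x, ‖v x‖ ≤ m) →
      ∀ x, ‖(toL2S F K c₀).symm (GprimeP F n K h c₀ cB a U₀ (RS F n K h c₀ cB U₀ (toL2S F K c₀ v))) x‖ ≤ C₁ * m)
    (hc3 : ∀ (v : Site (F.P K) 0 → Matrix (Fin 2) (Fin 2) ℂ) (m : ℝ), (∀ x, ‖v x‖ ≤ m) →
      ∀ x, ‖(toL2S F K c₀).symm (RS F n K h c₀ cB U₀ (GprimeP F n K h c₀ cB a U₀ (toL2S F K c₀ v))) x‖ ≤ C₃ * m)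
    (hDg : ∀ (v : Site (F.P K) 0 → Matrix (Fin 2) (Fin 2) ℂ) (m : ℝ), (∀ x, ‖v x‖ ≤ m) →
      ∀ b, ‖(toL2 F K c₀).symm (DL2 F n K c₀ U₀ (RS F n K h c₀ cB U₀ (GprimeP F n K h c₀ cB a U₀ (toL2S F K c₀ v)))) b‖ ≤ CDg * m)
    (hroom : 2 * (12 * F.L ^ (K - n) + 5) ≤ (F.P K).sitesPerDir 0)
    (hsmall : exists_curved_localGradient.choose * ((48 * α) * (6 * Real.sqrt 2 * Real.sqrt 10 + 6 * Real.sqrt 2)) ≤ 1 / 2) :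
    ∀ (v : Site (F.P K) 0 → Matrix (Fin 2) (Fin 2) ℂ) (m : ℝ), (∀ x, ‖v x‖ ≤ m) →
      ‖nabla115 (((F.L : ℝ)⁻¹) ^ (K - n)) (bgOfCfg F K U₀)
          (fun q : Bond 3 (periodsT3 F K) => (toL2 F K c₀).symm (DL2 F n K c₀ U₀ (GprimeP F n K h c₀ cB a U₀ (RS F n K h c₀ cB U₀
            (GprimeP F n K h c₀ cB a U₀ (toL2S F K c₀ v))))) ((bondEquiv F K).symm q))‖
        ≤ (2 * (exists_curved_localGradient.choose * ((Real.sqrt 2 * (2 * (exists_curved_localGradient.choose * ((Real.sqrt 2 * (C₁ * C₃)) * (2 + 2 * Real.sqrt 2 * (4 * α * (3 + 2457 * norm_bgOfCfg_axialT_sub_le.choose)) + (24 * Real.sqrt 10 + 48) * (48 * α) ^ 2) + (Real.sqrt 2 * C₃)) + 2 * Real.sqrt 2 * (48 * α) * (Real.sqrt 2 * (C₁ * C₃))))) * (2 + 2 * Real.sqrt 2 * (4 * α * (3 + 2457 * norm_bgOfCfg_axialT_sub_le.choose)) + (24 * Real.sqrt 10 + 48) * (48 * α) ^ 2) + (Real.sqrt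 2 * (32 * α * (2 * (exists_curved_localGradient.choose * ((Real.sqrt 2 * (C₁ * C₃)) * (2 + 2 * Real.sqrt 2 * (4 * α * (3 + 2457 * norm_bgOfCfg_axialT_sub_le.choose)) + (24 * Real.sqrt 10 + 48) * (48 * α) ^ 2) + (Real.sqrt 2 * C₃)) + 2 * Real.sqrt 2 * (48 * α) * (Real.sqrt 2 * (C₁ * C₃)))) + ((4 * α * (C₁ * C₃)) + (4 * α * (C₁ * C₃))) + 0 + 0 + ((4 * α * (C₁ * C₃)) + CDg)))) + 2 * Real.sqrt 2 * (48 * α) * (Real.sqrt 2 * (2 * (exists_curved_localGradient.choose * ((Real.sqrt 2 * (C₁ * C₃)) * (2 + 2 * Real.sqrt 2 * (4 * α * (3 + 2457 * norm_bgOfCfg_axialT_sub_le.choose)) + (24 * Real.sqrt 10 + 48) * (48 * α) ^ 2) + (Real.sqrt 2 * C₃)) + 2 * Real.sqrt 2 * (48 * α) * (Real.sqrt 2 * (C₁ * C₃)))))))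
          * m := by
  intro v m hv
  have hm : 0 ≤ m := (norm_nonneg _).trans (hv (Classical.arbitrary _))
  have hCg0 : 0 ≤ exists_curved_localGradient.choose := exists_curved_localGradient.choose_spec.1
  obtain ⟨hC0, -⟩ := norm_bgOfCfg_axialT_sub_le.choose_spec
  -- the componentwise row, read per unit `m`
  have hcomp := norm_covGradT_DL2_chain_le_of_letters F h c₀ cB a hα0 hα1 U₀ hreg ha hC₁ hC₃ hCDg hc1 hc3 hDg hroom hsmall v hv
  set B : ℝ := (2 * (exists_curved_localGradient.choose * ((Real.sqrt 2 * (2 * (exists_curved_localGradient.choose * ((Real.sqrt 2 * (C₁ * C₃)) * (2 + 2 * Real.sqrt 2 * (4 * α * (3 + 2457 * norm_bgOfCfg_axialT_sub_le.choose)) + (24 * Real.sqrt 10 + 48) * (48 * α) ^ 2) + (Real.sqrt 2 * C₃)) + 2 * Real.sqrt 2 * (48 * α) * (Real.sqrt 2 * (C₁ * C₃))))) * (2 + 2 * Real.sqrt 2 * (4 * α * (3 + 2457 * norm_bgOfCfg_axialT_sub_le.choose)) + (24 * Real.sqrt 10 + 48) * (48 * α) ^ 2) + (Real.sqrt 2 *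 (32 * α * (2 * (exists_curved_localGradient.choose * ((Real.sqrt 2 * (C₁ * C₃)) * (2 + 2 * Real.sqrt 2 * (4 * α * (3 + 2457 * norm_bgOfCfg_axialT_sub_le.choose)) + (24 * Real.sqrt 10 + 48) * (48 * α) ^ 2) + (Real.sqrt 2 * C₃)) + 2 * Real.sqrt 2 * (48 * α) * (Real.sqrt 2 * (C₁ * C₃)))) + ((4 * α * (C₁ * C₃)) + (4 * α * (C₁ * C₃))) + 0 + 0 + ((4 * α * (C₁ * C₃)) + CDg)))) + 2 * Real.sqrt 2 * (48 * α) * (Real.sqrt 2 * (2 * (exists_curved_localGradient.choose * ((Real.sqrt 2 * (C₁ * C₃)) * (2 + 2 * Real.sqrt 2 * (4 * α * (3 + 2457 * norm_bgOfCfg_axialT_sub_le.choose)) + (24 * Real.sqrt 10 + 48) * (48 * α) ^ 2) + (Real.sqrt 2 * C₃)) + 2 * Real.sqrt 2 * (48 * α) * (Real.sqrt 2 * (C₁ * C₃))))))) with hBdef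
  have hB : 0 ≤ B := by have := hα0.le; positivity
  have hBm : 0 ≤ B * m := mul_nonneg hB hm
  have hlin : 2 * (exists_curved_localGradient.choose * ((Real.sqrt 2 * (2 * (exists_curved_localGradient.choose * ((Real.sqrt 2 * (C₁ * (C₃ * m))) * (2 + 2 * Real.sqrt 2 * (4 * α * (3 + 2457 * norm_bgOfCfg_axialT_sub_le.choose)) + (24 * Real.sqrt 10 + 48) * (48 * α) ^ 2) + (Real.sqrt 2 * (C₃ * m))) + 2 * Real.sqrt 2 * (48 * α) * (Real.sqrt 2 * (C₁ * (C₃ * m)))))) * (2 + 2 * Real.sqrt 2 * (4 * α * (3 + 2457 * norm_bgOfCfg_axialT_sub_le.choose)) + (24 * Real.sqrt 10 + 48) * (48 * α) ^ 2) + (Real.sqrt 2 * (32 * α * (2 * (exists_curved_localGradient.choose * ((Real.sqrt 2 * (C₁ * (C₃ * m))) * (2 + 2 * Real.sqrt 2 * (4 * α * (3 + 2457 * norm_bgOfCfg_axialT_sub_le.choose)) + (24 * Real.sqrt 10 + 48) * (48 * α) ^ 2) + (Real.sqrt 2 * (C₃ * m))) + 2 * Real.sqrt 2 * (48 * α) *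 (Real.sqrt 2 * (C₁ * (C₃ * m))))) + ((4 * α * (C₁ * (C₃ * m))) + (4 * α * (C₁ * (C₃ * m)))) + 0 + 0 + ((4 * α * (C₁ * (C₃ * m))) + CDg * m)))) + 2 * Real.sqrt 2 * (48 * α) * (Real.sqrt 2 * (2 * (exists_curved_localGradient.choose * ((Real.sqrt 2 * (C₁ * (C₃ * m))) * (2 + 2 * Real.sqrt 2 * (4 * α * (3 + 2457 * norm_bgOfCfg_axialT_sub_le.choose)) + (24 * Real.sqrt 10 + 48) * (48 * α) ^ 2) + (Real.sqrt 2 * (C₃ * m))) + 2 * Real.sqrt 2 * (48 * α) * (Real.sqrt 2 * (C₁ * (C₃ * m)))))))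
      = B * m := by rw [hBdef]; ring
  refine (pi_norm_le_iff_of_nonneg hBm).2 fun qν => ?_
  obtain ⟨q, ν⟩ := qν
  obtain ⟨b, rfl⟩ := (bondEquiv F K).surjective q
  obtain ⟨x, μ⟩ := b
  rw [show (((F.L : ℝ)⁻¹) ^ (K - n)) = eta F n K from rfl, nabla115_bgOfCfg_eq_covGradT F c₀ U₀, ← hlin]
  exact hcomp μ ν x

end Summit.QuantumFields.YangMills.Theorems.Prop7ChainPotentialHessianRow

end
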